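import Mathlib
import HarnessLib
import Summits.ValiantsHypothesis.ValiantsHypothesis.Theses.MonotoneRestoration
import Literature.Computability.AlgebraicComplexity.VNPClosedUnderComposition
import Summits.ValiantsHypothesis.ValiantsHypothesis.Theorems.MonotoneRestorationOrbitRestorationLinearVolumeQPBlockDescent
import Summits.ValiantsHypothesis.ValiantsHypothesis.Theorems.MonotoneRestorationOrbitRestorationLinearVolumeQPDiNarrowSpanTight
import Summits.ValiantsHypothesis.ValiantsHypothesis.Theorems.MonotoneRestorationOrbitRestorationLinearVolumeQPHalfDegreeTight
import Summits.ValiantsHypothesis.ValiantsHypothesis.Theorems.MonotoneRestorationOrbitCompressionQPOrbitToNarrowOfDescent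

/-!
# Route MonotoneRestoration — aside `OrbitRestorationLinearVolumeQP` (stmt-ValiantsHypothesis-18294):
# BLOCK DESCENT, part 2 — R1 GIVES THE REGISTERED STUB'S CONCLUSION ON EVERY RESTRICTED FAMILY;
# the stub `LvNarrowSpan` and the crux AGREE on `{f↓ : f ∈ VP ∩ LV}`

Part 1 (`…BlockDescent.lean`): an off-diagonal block substitution `φ_n` (`Y ↦ X ⊗ N`, level `n + n` → level `n`)
maps the ONE-SORTED narrow span of width `w` into the BIPARTITE narrow span of the same width, in every degree.
This file draws the consequences in the item's currency.  For a family `f` on the square matrices put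
`f↓_n := φ_n(f_{n+n})` (the RESTRICTED family; for matrix-symmetric `f` this is `f_{n+n}` read on the principal
`n × n` block, `aeval_block_eq_aeval_principal`, `restrict_eq_principal_of_lv`).

* `isVPFamily_restrict` — `f ∈ VP ⟹ f↓ ∈ VP` (`IsVPFamily.reindex` along `n ↦ n + n`, `IsVPFamily.aeval` with
  variables/zeros);
* `lv_restrict` — `f` in the linear-volume class (constant `c`) ⟹ `f↓` in the linear-volume class (constant `2c`):
  `φ_n` reads the level-`n + n` expansion one level down, pattern by pattern (`BlockDescent.aeval_block_homPoly`);
* `restrict_mem_narrowSpan_of_orbitRestorationLinearVolumeQP` — **R1 ⟹ for every `VP ∩ LV` family `f`, ONE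
  constant `c` such that for EVERY `n` (no degree threshold) `f↓_n` lies in the span of the homomorphism
  polynomials of BIPARTITE patterns of treewidth `≤ (log₂ n + c)^c`** — the conclusion of `stub_lvNarrowSpan` for
  `f↓` (R1 ⟹ `LvDiNarrowSpan` at level `n + n`, p829138, then block descent);
* `restrict_mem_narrowSpan_of_lvNarrowSpan` — the registered stub gives the same (trivially, by the two closure
  lemmas): STUB AND CRUX AGREE ON RESTRICTED FAMILIES;
* `mem_narrowSpan_of_selfRestricting` — for SELF-RESTRICTING families (`f_n = φ_n(f_{n+n})`, e.g. level-uniform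
  expansion data) R1 gives the stub's conclusion for `f` itself.

WHAT THIS SAYS ABOUT THE LINE (honest label).  The only VH-free residue between line `birth` and the crux was
DESCENT above the injective threshold (`SubThresholdDescent.subThreshold_descent` covers `2 · deg ≤ n`).  Block
descent covers every degree but lands one level down: under R1 the bipartite-narrowness asked by the stub holds for
`f_{n+n}` restricted to an `n × n` block, for every `f ∈ VP ∩ LV` and every `n`.  The remaining gap is therefore
exactly LIFTING: is every `VP ∩ LV` family `g` of the form `f↓` for some `f ∈ VP ∩ LV` (equivalently, does the
level-`n` expansion of `g_n`, re-evaluated at level `n + n`, stay in `VP`)?  If yes, `LvNarrowSpan ⟺ R1` and the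
registered skeleton is tight; a `VP ∩ LV` family that is NOT a restriction is where any separation between the stub
and the crux must live.  The stub (Dwivedi–Pago–Seppelt Outlook Q3 at qp scale), R1 and VP ≠ VNP are NOT moved.
Def-free helper (`--supports stmt-ValiantsHypothesis-18294`); nothing here is a named fact.

References: Dwivedi–Pago–Seppelt 2026 (arXiv:2601.09343) eq. (1), Outlook Q3; Dawar–Pago–Seppelt 2025
(arXiv:2502.06740) Thm 1.1, §5; Bürgisser 2000, Def. 2.1 (p-bounded reindexing and substitution).
-/

noncomputable section

open scoped Classical

-- `Summit.ValiantsHypothesis.ValiantsHypothesis.…` is the tree's single-conjunct layout (Sub = Summit).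
set_option linter.dupNamespace false

namespace Summit.ValiantsHypothesis.ValiantsHypothesis.Theorems.BlockDescentRestricted

open Literature.Computability.AlgebraicComplexity MvPolynomial
open Literature.Combinatorics.SimpleGraph (treewidth)
open Summit.ValiantsHypothesis.ValiantsHypothesis.Theorems
open Summit.ValiantsHypothesis.ValiantsHypothesis.Theorems.BlockDescent

/-! ### Entries of a block substitution are variables or zero -/

/-- Every entry of an off-diagonal block substitution is a variable or `0`. [folklore] -/
theorem block_entry_cases {n : ℕ} (φ : Fin (n + n) × Fin (n + n) → MvPolynomial (Fin n × Fin n) ℂ)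
    (hφ : ∀ i j : Fin n, φ (finSumFinEquiv (Sum.inl i), finSumFinEquiv (Sum.inr j)) = X (i, j) ∧
      φ (finSumFinEquiv (Sum.inl i), finSumFinEquiv (Sum.inl j)) = 0 ∧
      φ (finSumFinEquiv (Sum.inr i), finSumFinEquiv (Sum.inl j)) = 0 ∧
      φ (finSumFinEquiv (Sum.inr i), finSumFinEquiv (Sum.inr j)) = 0)
    (ij : Fin (n + n) × Fin (n + n)) : φ ij = 0 ∨ ∃ p : Fin n × Fin n, φ ij = X p := by
  obtain ⟨u, v⟩ := ij
  obtain ⟨x, rfl⟩ := finSumFinEquiv.surjective u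
  obtain ⟨y, rfl⟩ := finSumFinEquiv.surjective v
  rcases x with i | i <;> rcases y with j | j
  · exact Or.inl (hφ i j).2.1
  · exact Or.inr ⟨(i, j), (hφ i j).1⟩
  · exact Or.inl (hφ i j).2.2.1
  · exact Or.inl (hφ i j).2.2.2

/-- Hence every entry of an off-diagonal block substitution has circuit complexity `0`. [folklore] -/
theorem complexity_block_entry {n : ℕ} (φ : Fin (n + n) × Fin (n + n) → MvPolynomial (Fin n × Fin n) ℂ)
    (hφ : ∀ i j : Fin n, φ (finSumFinEquiv (Sum.inl i), finSumFinEquiv (Sum.inr j)) = X (i, j) ∧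
      φ (finSumFinEquiv (Sum.inl i), finSumFinEquiv (Sum.inl j)) = 0 ∧
      φ (finSumFinEquiv (Sum.inr i), finSumFinEquiv (Sum.inl j)) = 0 ∧
      φ (finSumFinEquiv (Sum.inr i), finSumFinEquiv (Sum.inr j)) = 0)
    (ij : Fin (n + n) × Fin (n + n)) : complexity (φ ij) = 0 := by
  rcases block_entry_cases φ hφ ij with h | ⟨p, h⟩
  · rw [h, ← C_0]; exact complexity_C_holds _
  · rw [h]; exact complexity_X_holds _

/-- … and total degree `≤ 1`. [folklore] -/
theorem totalDegree_block_entry {n : ℕ} (φ : Fin (n + n) × Fin (n + n) → MvPolynomial (Fin n × Fin n) ℂ)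
    (hφ : ∀ i j : Fin n, φ (finSumFinEquiv (Sum.inl i), finSumFinEquiv (Sum.inr j)) = X (i, j) ∧
      φ (finSumFinEquiv (Sum.inl i), finSumFinEquiv (Sum.inl j)) = 0 ∧
      φ (finSumFinEquiv (Sum.inr i), finSumFinEquiv (Sum.inl j)) = 0 ∧
      φ (finSumFinEquiv (Sum.inr i), finSumFinEquiv (Sum.inr j)) = 0)
    (ij : Fin (n + n) × Fin (n + n)) : (φ ij).totalDegree ≤ 1 := by
  rcases block_entry_cases φ hφ ij with h | ⟨p, h⟩
  · rw [h, totalDegree_zero]; exact Nat.zero_le _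
  · rw [h, totalDegree_X]

/-! ### For matrix-symmetric polynomials the off-diagonal block is the principal block -/

/-- **Off-diagonal block = principal block, for matrix-symmetric polynomials.**  If `p` (level `n + n`) is
invariant under independent row and column permutations, then substituting the off-diagonal block matrix
`X ⊗ N` (an off-diagonal block substitution `φ`) gives the same result as substituting the PRINCIPAL block matrix
`X ⊕ 0` (`ψ`: `y_(inl i, inl j) ↦ x_(i,j)`, all other variables `↦ 0`): the two differ by the column permutation
swapping the two blocks.  So for a matrix-symmetric family — e.g. any family expanded in bipartite homomorphism
polynomials — the restricted polynomial `φ_n(f_{n+n})` IS `f_{n+n}` read on the principal `n × n` block.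
[folklore] -/
theorem aeval_block_eq_aeval_principal {n : ℕ}
    (φ ψ : Fin (n + n) × Fin (n + n) → MvPolynomial (Fin n × Fin n) ℂ)
    (hφ : ∀ i j : Fin n, φ (finSumFinEquiv (Sum.inl i), finSumFinEquiv (Sum.inr j)) = X (i, j) ∧
      φ (finSumFinEquiv (Sum.inl i), finSumFinEquiv (Sum.inl j)) = 0 ∧
      φ (finSumFinEquiv (Sum.inr i), finSumFinEquiv (Sum.inl j)) = 0 ∧
      φ (finSumFinEquiv (Sum.inr i), finSumFinEquiv (Sum.inr j)) = 0)
    (hψ : ∀ i j : Fin n, ψ (finSumFinEquiv (Sum.inl i), finSumFinEquiv (Sum.inl j)) = X (i, j) ∧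
      ψ (finSumFinEquiv (Sum.inl i), finSumFinEquiv (Sum.inr j)) = 0 ∧
      ψ (finSumFinEquiv (Sum.inr i), finSumFinEquiv (Sum.inl j)) = 0 ∧
      ψ (finSumFinEquiv (Sum.inr i), finSumFinEquiv (Sum.inr j)) = 0)
    (p : MvPolynomial (Fin (n + n) × Fin (n + n)) ℂ)
    (hp : ∀ σ τ : Equiv.Perm (Fin (n + n)),
      rename (fun ij : Fin (n + n) × Fin (n + n) => (σ ij.1, τ ij.2)) p = p) :
    aeval φ p = aeval ψ p := by
  -- the column permutation swapping the two blocks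
  let τ : Equiv.Perm (Fin (n + n)) :=
    finSumFinEquiv.symm.trans ((Equiv.sumComm (Fin n) (Fin n)).trans finSumFinEquiv)
  have hτl : ∀ j : Fin n, τ (finSumFinEquiv (Sum.inl j)) = finSumFinEquiv (Sum.inr j) := fun j => by
    simp only [τ, Equiv.trans_apply, Equiv.symm_apply_apply, Equiv.sumComm_apply, Sum.swap_inl]
  have hτr : ∀ j : Fin n, τ (finSumFinEquiv (Sum.inr j)) = finSumFinEquiv (Sum.inl j) := fun j => by
    simp only [τ, Equiv.trans_apply, Equiv.symm_apply_apply, Equiv.sumComm_apply, Sum.swap_inr]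
  have hfun : (φ ∘ fun ij : Fin (n + n) × Fin (n + n) => ((1 : Equiv.Perm (Fin (n + n))) ij.1, τ ij.2)) = ψ := by
    funext ij
    obtain ⟨u, v⟩ := ij
    obtain ⟨x, rfl⟩ := finSumFinEquiv.surjective u
    obtain ⟨y, rfl⟩ := finSumFinEquiv.surjective v
    simp only [Function.comp_apply, Equiv.Perm.coe_one, id_eq]
    rcases x with i | i <;> rcases y with j | j
    · rw [hτl, (hφ i j).1, (hψ i j).1]
    · rw [hτr, (hφ i j).2.1, (hψ i j).2.1]
    · rw [hτl, (hφ i j).2.2.2, (hψ i j).2.2.1]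
    · rw [hτr, (hφ i j).2.2.1, (hψ i j).2.2.2]
  conv_lhs => rw [← hp 1 τ]
  rw [aeval_rename, hfun]

/-- Hence for a family of the linear-volume class (level by level a combination of bipartite homomorphism
polynomials, so matrix-symmetric: `OrbitRestorationLinearVolumeQPHalfDegree.rename_perm_lvExpansion`) the restricted
polynomial `φ_n(f_{n+n})` is `f_{n+n}` READ ON THE PRINCIPAL `n × n` BLOCK (`ψ_n(f_{n+n})`, `Y ↦ X ⊕ 0`).
[folklore] -/
theorem restrict_eq_principal_of_lv {n : ℕ}
    (φ ψ : Fin (n + n) × Fin (n + n) → MvPolynomial (Fin n × Fin n) ℂ)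
    (hφ : ∀ i j : Fin n, φ (finSumFinEquiv (Sum.inl i), finSumFinEquiv (Sum.inr j)) = X (i, j) ∧
      φ (finSumFinEquiv (Sum.inl i), finSumFinEquiv (Sum.inl j)) = 0 ∧
      φ (finSumFinEquiv (Sum.inr i), finSumFinEquiv (Sum.inl j)) = 0 ∧
      φ (finSumFinEquiv (Sum.inr i), finSumFinEquiv (Sum.inr j)) = 0)
    (hψ : ∀ i j : Fin n, ψ (finSumFinEquiv (Sum.inl i), finSumFinEquiv (Sum.inl j)) = X (i, j) ∧
      ψ (finSumFinEquiv (Sum.inl i), finSumFinEquiv (Sum.inr j)) = 0 ∧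
      ψ (finSumFinEquiv (Sum.inr i), finSumFinEquiv (Sum.inl j)) = 0 ∧
      ψ (finSumFinEquiv (Sum.inr i), finSumFinEquiv (Sum.inr j)) = 0)
    (f : (n : ℕ) → MvPolynomial (Fin n × Fin n) ℂ)
    (hLV : ∃ (c : ℕ) (m : ℕ → ℕ) (a b : (n : ℕ) → Fin (m n) → ℕ)
        (E : (n : ℕ) → (i : Fin (m n)) → Multiset (Fin (a n i) × Fin (b n i)))
        (α : (n : ℕ) → Fin (m n) → ℂ),
      (∀ n, m n ≤ (n + 2) ^ c) ∧ (∀ n i, a n i + b n i ≤ c * (n + 1)) ∧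
        ∀ n, f n = ∑ i : Fin (m n), C (α n i) * homPoly (E n i) n ℂ) :
    aeval φ (f (n + n)) = aeval ψ (f (n + n)) := by
  obtain ⟨c, m, a, b, E, α, -, -, hf⟩ := hLV
  rw [hf (n + n)]
  exact aeval_block_eq_aeval_principal φ ψ hφ hψ _ fun σ τ =>
    OrbitRestorationLinearVolumeQPHalfDegree.rename_perm_lvExpansion (a (n + n)) (b (n + n)) (E (n + n))
      (α (n + n)) σ τ

/-! ### Restricted families stay in `VP` -/

/-- **Restriction preserves `VP`.**  For a `VP` family `f` on the square matrices and off-diagonal block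
substitutions `φ_n`, the RESTRICTED family `f↓_n := φ_n(f_{n+n})` (the level-`n + n` member with the matrix
`X ⊗ N` substituted, `N` the nilpotent `2 × 2` Jordan block) is a `VP` family: reindex along `n ↦ n + n`
(`IsVPFamily.reindex`) and substitute variables/zeros (`IsVPFamily.aeval`). [folklore] -/
theorem isVPFamily_restrict (φ : (n : ℕ) → Fin (n + n) × Fin (n + n) → MvPolynomial (Fin n × Fin n) ℂ)
    (hφ : ∀ n (i j : Fin n), φ n (finSumFinEquiv (Sum.inl i), finSumFinEquiv (Sum.inr j)) = X (i, j) ∧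
      φ n (finSumFinEquiv (Sum.inl i), finSumFinEquiv (Sum.inl j)) = 0 ∧
      φ n (finSumFinEquiv (Sum.inr i), finSumFinEquiv (Sum.inl j)) = 0 ∧
      φ n (finSumFinEquiv (Sum.inr i), finSumFinEquiv (Sum.inr j)) = 0)
    (f : (n : ℕ) → MvPolynomial (Fin n × Fin n) ℂ) (hVP : IsVPFamily f) :
    IsVPFamily fun n => aeval (φ n) (f (n + n)) := by
  have ht : IsPBounded fun n => n + n := ⟨2, fun n => by nlinarith⟩
  have h2 := IsVPFamily.reindex hVP ht
  refine IsVPFamily.aeval (ρ := fun n => Fin (n + n) × Fin (n + n)) h2 φ ⟨2, fun n => ?_⟩ ⟨1, fun n => ?_⟩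
    ⟨0, fun n => ?_⟩
  · show Fintype.card (Fin n × Fin n) ≤ n ^ 2 + 2
    simp only [Fintype.card_prod, Fintype.card_fin]; nlinarith
  · show (Finset.univ.sup fun ij => (φ n ij).totalDegree) ≤ n ^ 1 + 1
    exact (Finset.sup_le fun ij _ => totalDegree_block_entry (φ n) (hφ n) ij).trans (by omega)
  · show (∑ ij, complexity (φ n ij)) ≤ n ^ 0 + 0
    rw [Finset.sum_eq_zero fun ij _ => complexity_block_entry (φ n) (hφ n) ij]
    exact Nat.zero_le _

/-! ### Restricted families stay in the linear-volume class -/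

/-- `(n + n + 2)^c ≤ (n + 2)^(2c)`. [folklore] -/
theorem pow_double_le (n c : ℕ) : (n + n + 2) ^ c ≤ (n + 2) ^ (2 * c) := by
  rw [pow_mul]
  exact Nat.pow_le_pow_left (by nlinarith) c

/-- **Restriction preserves the linear-volume class.**  If `f` is, level by level, a combination of
`≤ (n+2)^c` homomorphism polynomials of bipartite patterns with `≤ c (n+1)` vertices, then so is the restricted
family `f↓_n = φ_n(f_{n+n})` (constant `2c`): `φ_n` reads the level-`n + n` expansion one level down, pattern by
pattern, up to the positive integer factors `2^{#isolated vertices}` (`BlockDescent.aeval_block_homPoly`).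
[folklore] -/
theorem lv_restrict (φ : (n : ℕ) → Fin (n + n) × Fin (n + n) → MvPolynomial (Fin n × Fin n) ℂ)
    (hφ : ∀ n (i j : Fin n), φ n (finSumFinEquiv (Sum.inl i), finSumFinEquiv (Sum.inr j)) = X (i, j) ∧
      φ n (finSumFinEquiv (Sum.inl i), finSumFinEquiv (Sum.inl j)) = 0 ∧
      φ n (finSumFinEquiv (Sum.inr i), finSumFinEquiv (Sum.inl j)) = 0 ∧
      φ n (finSumFinEquiv (Sum.inr i), finSumFinEquiv (Sum.inr j)) = 0)
    (f : (n : ℕ) → MvPolynomial (Fin n × Fin n) ℂ)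
    (hLV : ∃ (c : ℕ) (m : ℕ → ℕ) (a b : (n : ℕ) → Fin (m n) → ℕ)
        (E : (n : ℕ) → (i : Fin (m n)) → Multiset (Fin (a n i) × Fin (b n i)))
        (α : (n : ℕ) → Fin (m n) → ℂ),
      (∀ n, m n ≤ (n + 2) ^ c) ∧ (∀ n i, a n i + b n i ≤ c * (n + 1)) ∧
        ∀ n, f n = ∑ i : Fin (m n), C (α n i) * homPoly (E n i) n ℂ) :
    ∃ (c : ℕ) (m : ℕ → ℕ) (a b : (n : ℕ) → Fin (m n) → ℕ)
        (E : (n : ℕ) → (i : Fin (m n)) → Multiset (Fin (a n i) × Fin (b n i)))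
        (α : (n : ℕ) → Fin (m n) → ℂ),
      (∀ n, m n ≤ (n + 2) ^ c) ∧ (∀ n i, a n i + b n i ≤ c * (n + 1)) ∧
        ∀ n, (aeval (φ n) (f (n + n))) = ∑ i : Fin (m n), C (α n i) * homPoly (E n i) n ℂ := by
  obtain ⟨c, m, a, b, E, α, hm, hab, hf⟩ := hLV
  -- the positive integer factors `2^{#isolated vertices}` picked up by reading one level down
  have hN : ∀ n (i : Fin (m (n + n))), ∃ N : ℕ,
      aeval (φ n) (homPoly (E (n + n) i) (n + n) ℂ) = (N : ℂ) • homPoly (E (n + n) i) n ℂ :=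
    fun n i => ⟨_, aeval_block_homPoly (φ n) (hφ n) (E (n + n) i)⟩
  choose N hN using hN
  refine ⟨2 * c, fun n => m (n + n), fun n i => a (n + n) i, fun n i => b (n + n) i, fun n i => E (n + n) i,
    fun n i => α (n + n) i * (N n i : ℂ), fun n => (hm (n + n)).trans (pow_double_le n c),
    fun n i => (hab (n + n) i).trans ?_, fun n => ?_⟩
  · nlinarith
  · rw [hf (n + n), map_sum]
    refine Finset.sum_congr rfl fun i _ => ?_
    rw [map_mul, aeval_C, MvPolynomial.algebraMap_eq, hN n i, smul_eq_C_mul, ← mul_assoc, ← C_mul]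

/-! ### R1 gives the registered stub's conclusion on every restricted family -/

/-- Width bookkeeping: `(log₂ (n+n) + c)^c ≤ (log₂ n + (c+1))^(c+1)`. [folklore] -/
theorem width_double_le (n c : ℕ) :
    (Nat.log 2 (n + n) + c) ^ c ≤ (Nat.log 2 n + (c + 1)) ^ (c + 1) := by
  have hlog : Nat.log 2 (n + n) ≤ Nat.log 2 n + 1 := by
    rcases Nat.eq_zero_or_pos n with rfl | hn
    · simp
    · rw [← two_mul, mul_comm, Nat.log_mul_base (by norm_num) hn.ne']
  calc (Nat.log 2 (n + n) + c) ^ c ≤ (Nat.log 2 n + (c + 1)) ^ c :=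
        Nat.pow_le_pow_left (by omega) c
    _ ≤ (Nat.log 2 n + (c + 1)) ^ (c + 1) := Nat.pow_le_pow_right (by omega) (by omega)

/-- **R1 ⟹ THE REGISTERED STUB'S CONCLUSION ON EVERY RESTRICTED FAMILY.**  Assume
`OrbitRestorationLinearVolumeQP` (R1).  Then for every `VP ∩ LV` family `f` there is one constant `c` such that,
for EVERY `n` (every degree, no threshold), the restricted polynomial `φ_n(f_{n+n})` lies in the span of the
homomorphism polynomials of BIPARTITE patterns of treewidth `≤ (log₂ n + c)^c` — the conclusion of
`stub_lvNarrowSpan`, for the family `f↓`.  (R1 ⟹ `LvDiNarrowSpan` at level `n + n`,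
`OrbitRestorationLinearVolumeQPDiNarrowSpan.lvDiNarrowSpan_of_orbitRestorationLinearVolumeQP`; then BLOCK DESCENT
`BlockDescent.block_descent_span`.) [folklore] -/
theorem restrict_mem_narrowSpan_of_orbitRestorationLinearVolumeQP
    (hR1 : Summit.ValiantsHypothesis.ValiantsHypothesis.Theses.MonotoneRestoration.OrbitRestorationLinearVolumeQP)
    (φ : (n : ℕ) → Fin (n + n) × Fin (n + n) → MvPolynomial (Fin n × Fin n) ℂ)
    (hφ : ∀ n (i j : Fin n), φ n (finSumFinEquiv (Sum.inl i), finSumFinEquiv (Sum.inr j)) = X (i, j) ∧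
      φ n (finSumFinEquiv (Sum.inl i), finSumFinEquiv (Sum.inl j)) = 0 ∧
      φ n (finSumFinEquiv (Sum.inr i), finSumFinEquiv (Sum.inl j)) = 0 ∧
      φ n (finSumFinEquiv (Sum.inr i), finSumFinEquiv (Sum.inr j)) = 0)
    (f : (n : ℕ) → MvPolynomial (Fin n × Fin n) ℂ) (hVP : IsVPFamily f)
    (hLV : ∃ (c : ℕ) (m : ℕ → ℕ) (a b : (n : ℕ) → Fin (m n) → ℕ)
        (E : (n : ℕ) → (i : Fin (m n)) → Multiset (Fin (a n i) × Fin (b n i)))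
        (α : (n : ℕ) → Fin (m n) → ℂ),
      (∀ n, m n ≤ (n + 2) ^ c) ∧ (∀ n i, a n i + b n i ≤ c * (n + 1)) ∧
        ∀ n, f n = ∑ i : Fin (m n), C (α n i) * homPoly (E n i) n ℂ) :
    ∃ c : ℕ, ∀ n : ℕ, aeval (φ n) (f (n + n)) ∈ Submodule.span ℂ {q : MvPolynomial (Fin n × Fin n) ℂ |
      ∃ (a b : ℕ) (F : Multiset (Fin a × Fin b)),
        treewidth (SimpleGraph.fromRel fun u v : Fin a ⊕ Fin b =>
            ∃ e ∈ F, u = Sum.inl e.1 ∧ v = Sum.inr e.2) ≤ (Nat.log 2 n + c) ^ c ∧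
          q = homPoly F n ℂ} := by
  obtain ⟨c, hc⟩ :=
    OrbitRestorationLinearVolumeQPDiNarrowSpan.lvDiNarrowSpan_of_orbitRestorationLinearVolumeQP hR1 f hVP hLV
  refine ⟨c + 1, fun n => OrbitToNarrowOfDescent.narrowSpan_mono n (width_double_le n c) ?_⟩
  exact block_descent_span (φ n) (hφ n) _ _ (hc (n + n))

/-- **The registered stub gives the same conclusion on restricted families** (trivially: `f ↦ f↓` preserves
`VP ∩ LV`, `isVPFamily_restrict` + `lv_restrict`).  So the stub `LvNarrowSpan` (as the hypothesis of
`OrbitRestorationLinearVolumeQPNarrow.orbitRestorationLinearVolumeQP_of_lvNarrowSpan`) and the crux R1 AGREE on the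
class of restricted families `{f↓ : f ∈ VP ∩ LV}`; the residue of the descent question is the passage from
`φ_n(f_{n+n})` to `f_n`. [folklore] -/
theorem restrict_mem_narrowSpan_of_lvNarrowSpan
    (h : ∀ f : (n : ℕ) → MvPolynomial (Fin n × Fin n) ℂ, IsVPFamily f →
      (∃ (c : ℕ) (m : ℕ → ℕ) (a b : (n : ℕ) → Fin (m n) → ℕ)
          (E : (n : ℕ) → (i : Fin (m n)) → Multiset (Fin (a n i) × Fin (b n i)))
          (α : (n : ℕ) → Fin (m n) → ℂ),
        (∀ n, m n ≤ (n + 2) ^ c) ∧ (∀ n i, a n i + b n i ≤ c * (n + 1)) ∧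
          ∀ n, f n = ∑ i : Fin (m n), C (α n i) * homPoly (E n i) n ℂ) →
      ∃ c : ℕ, ∀ n : ℕ, f n ∈ Submodule.span ℂ
        {p : MvPolynomial (Fin n × Fin n) ℂ | ∃ (a b : ℕ) (E : Multiset (Fin a × Fin b)),
          treewidth (SimpleGraph.fromRel fun u v : Fin a ⊕ Fin b =>
                ∃ e ∈ E, u = Sum.inl e.1 ∧ v = Sum.inr e.2) ≤ (Nat.log 2 n + c) ^ c ∧
            p = homPoly E n ℂ})
    (φ : (n : ℕ) → Fin (n + n) × Fin (n + n) → MvPolynomial (Fin n × Fin n) ℂ)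
    (hφ : ∀ n (i j : Fin n), φ n (finSumFinEquiv (Sum.inl i), finSumFinEquiv (Sum.inr j)) = X (i, j) ∧
      φ n (finSumFinEquiv (Sum.inl i), finSumFinEquiv (Sum.inl j)) = 0 ∧
      φ n (finSumFinEquiv (Sum.inr i), finSumFinEquiv (Sum.inl j)) = 0 ∧
      φ n (finSumFinEquiv (Sum.inr i), finSumFinEquiv (Sum.inr j)) = 0)
    (f : (n : ℕ) → MvPolynomial (Fin n × Fin n) ℂ) (hVP : IsVPFamily f)
    (hLV : ∃ (c : ℕ) (m : ℕ → ℕ) (a b : (n : ℕ) → Fin (m n) → ℕ)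
        (E : (n : ℕ) → (i : Fin (m n)) → Multiset (Fin (a n i) × Fin (b n i)))
        (α : (n : ℕ) → Fin (m n) → ℂ),
      (∀ n, m n ≤ (n + 2) ^ c) ∧ (∀ n i, a n i + b n i ≤ c * (n + 1)) ∧
        ∀ n, f n = ∑ i : Fin (m n), C (α n i) * homPoly (E n i) n ℂ) :
    ∃ c : ℕ, ∀ n : ℕ, aeval (φ n) (f (n + n)) ∈ Submodule.span ℂ {q : MvPolynomial (Fin n × Fin n) ℂ |
      ∃ (a b : ℕ) (F : Multiset (Fin a × Fin b)),
        treewidth (SimpleGraph.fromRel fun u v : Fin a ⊕ Fin b =>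
            ∃ e ∈ F, u = Sum.inl e.1 ∧ v = Sum.inr e.2) ≤ (Nat.log 2 n + c) ^ c ∧
          q = homPoly F n ℂ} :=
  h _ (isVPFamily_restrict φ hφ f hVP) (lv_restrict φ hφ f hLV)

/-- **SELF-RESTRICTING (projective) families: R1 gives the stub's conclusion for `f` itself.**  If a `VP ∩ LV`
family satisfies `f_n = φ_n(f_{n+n})` for all `n` (its level-`n + n` member restricted to the off-diagonal block
IS its level-`n` member — e.g. level-uniform expansion data without isolated vertices,
`BlockDescent.aeval_block_homPoly_of_noIsolated`), then under R1 every level `f_n` lies in the bipartite narrow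
span of width `(log₂ n + c)^c`: on this subclass the registered stub and the crux coincide outright. [folklore] -/
theorem mem_narrowSpan_of_selfRestricting
    (hR1 : Summit.ValiantsHypothesis.ValiantsHypothesis.Theses.MonotoneRestoration.OrbitRestorationLinearVolumeQP)
    (φ : (n : ℕ) → Fin (n + n) × Fin (n + n) → MvPolynomial (Fin n × Fin n) ℂ)
    (hφ : ∀ n (i j : Fin n), φ n (finSumFinEquiv (Sum.inl i), finSumFinEquiv (Sum.inr j)) = X (i, j) ∧
      φ n (finSumFinEquiv (Sum.inl i), finSumFinEquiv (Sum.inl j)) = 0 ∧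
      φ n (finSumFinEquiv (Sum.inr i), finSumFinEquiv (Sum.inl j)) = 0 ∧
      φ n (finSumFinEquiv (Sum.inr i), finSumFinEquiv (Sum.inr j)) = 0)
    (f : (n : ℕ) → MvPolynomial (Fin n × Fin n) ℂ) (hVP : IsVPFamily f)
    (hLV : ∃ (c : ℕ) (m : ℕ → ℕ) (a b : (n : ℕ) → Fin (m n) → ℕ)
        (E : (n : ℕ) → (i : Fin (m n)) → Multiset (Fin (a n i) × Fin (b n i)))
        (α : (n : ℕ) → Fin (m n) → ℂ),
      (∀ n, m n ≤ (n + 2) ^ c) ∧ (∀ n i, a n i + b n i ≤ c * (n + 1)) ∧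
        ∀ n, f n = ∑ i : Fin (m n), C (α n i) * homPoly (E n i) n ℂ)
    (hself : ∀ n, f n = aeval (φ n) (f (n + n))) :
    ∃ c : ℕ, ∀ n : ℕ, f n ∈ Submodule.span ℂ {q : MvPolynomial (Fin n × Fin n) ℂ |
      ∃ (a b : ℕ) (F : Multiset (Fin a × Fin b)),
        treewidth (SimpleGraph.fromRel fun u v : Fin a ⊕ Fin b =>
            ∃ e ∈ F, u = Sum.inl e.1 ∧ v = Sum.inr e.2) ≤ (Nat.log 2 n + c) ^ c ∧
          q = homPoly F n ℂ} := by
  obtain ⟨c, hc⟩ := restrict_mem_narrowSpan_of_orbitRestorationLinearVolumeQP hR1 φ hφ f hVP hLV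
  exact ⟨c, fun n => (hself n) ▸ hc n⟩

end Summit.ValiantsHypothesis.ValiantsHypothesis.Theorems.BlockDescentRestricted

end
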